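import Mathlib
import Literature.RepresentationTheory.FiniteGroups.KLRGradedCellularBasis
import Summits.MatrixMultiplication.MatrixMultiplication.Theorems.SnSubsetDichotomyNoThresholdSubsetTripleSwSumRowParity
import Summits.MatrixMultiplication.MatrixMultiplication.Theorems.SnSubsetDichotomyNoThresholdSubsetTripleNeSumColParity

/-!
# The increment identity: `J(T)` as a sum of parity charges

Stub `stub_pairDiff_eq_chargeSum` of line `klr-graded-polynomial-method` (crux
`SnSubsetDichotomy.NoThresholdSubsetTriple`, stmt-MatrixMultiplication-8302).

For a standard Young tableau `T` of shape `μ ⊢ n` (growth sequence `T.1 j = (row, col)` of the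
entry `j`, sign `π_j = (−1)^(row + col)`), the parity-signed pair statistic

  `J(T) = Σ_{j < k} π_j π_k ([cell j strictly SW of cell k] − [cell j strictly NE of cell k])`

equals `Σ_k π_k · (row charge below k − column charge right of k)`, where the row charge below
`k` is `Σ_{rows i > row k} (−1)^i [#{j < k in row i} odd]` and the column charge right of `k` is
`Σ_{columns i > col k} (−1)^i [#{j < k in column i} odd]`.

Proof.  Write the difference of the two double sums as a single sum over `k` of differences
(`Finset.sum_sub_distrib`) and rewrite the two inner sums by the accepted tree theorems
`stub_swSum_rowParity` (SW inner sum = `π_k ·` row charge) and `stub_neSum_colParity`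
(NE inner sum = `π_k ·` column charge); what is left is `a * b - a * c = a * (b - c)`.
-/

open scoped BigOperators
open Literature.NumberTheory.DiophantineGeometry (StdFilling)

namespace Summit.MatrixMultiplication.MatrixMultiplication.Theorems

set_option linter.dupNamespace false in -- deliberate Summit.<S>.<P> duplicate
/-- **Stub `stub_pairDiff_eq_chargeSum` (line `klr-graded-polynomial-method`, crux
`SnSubsetDichotomy.NoThresholdSubsetTriple`, stmt-MatrixMultiplication-8302): the increment
identity, assembled.**  The parity-signed SW-minus-NE pair count `J(T)` of a standard Young
tableau `T` of shape `μ ⊢ n` equals the sum over entries `k` of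
`π_k · (row charge below k − column charge right of k)`.  Immediate from
`stub_swSum_rowParity` and `stub_neSum_colParity` (one per inner sum) and
`Finset.sum_sub_distrib`, `mul_sub`. [folklore] -/
theorem stub_pairDiff_eq_chargeSum : ∀ (n : ℕ) (μ : Nat.Partition n) (T : StdFilling n μ.youngDiagram),
    ((∑ k : Fin n, ∑ j ∈ Finset.univ.filter
        (fun j : Fin n => j < k ∧ (T.1 k).1 < (T.1 j).1 ∧ (T.1 j).2 < (T.1 k).2),
        (-1 : ℤ) ^ ((T.1 j).1 + (T.1 j).2 + (T.1 k).1 + (T.1 k).2)) -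
      (∑ k : Fin n, ∑ j ∈ Finset.univ.filter
        (fun j : Fin n => j < k ∧ (T.1 j).1 < (T.1 k).1 ∧ (T.1 k).2 < (T.1 j).2),
        (-1 : ℤ) ^ ((T.1 j).1 + (T.1 j).2 + (T.1 k).1 + (T.1 k).2))) =
    ∑ k : Fin n, (-1 : ℤ) ^ ((T.1 k).1 + (T.1 k).2) *
      ((∑ i ∈ Finset.range n, (if (T.1 k).1 < i ∧
          Odd ((Finset.univ.filter (fun j : Fin n => j < k ∧ (T.1 j).1 = i)).card) then (-1 : ℤ) ^ i else 0)) -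
       (∑ i ∈ Finset.range n, (if (T.1 k).2 < i ∧
          Odd ((Finset.univ.filter (fun j : Fin n => j < k ∧ (T.1 j).2 = i)).card) then (-1 : ℤ) ^ i else 0))) := by
  intro n μ T
  rw [← Finset.sum_sub_distrib]
  refine Finset.sum_congr rfl fun k _ => ?_
  rw [stub_swSum_rowParity n μ T k, stub_neSum_colParity n μ T k, mul_sub]

end Summit.MatrixMultiplication.MatrixMultiplication.Theorems
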